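import Mathlib

/-!
# `UnitriangularCostShape` — Product model, part 1: variables, the substitution `σ_c` and the linear form `n_c`; group law

Crux `stmt-MatrixMultiplication-7724` (`NilpotentLieHosts.UnitriangularCostShape`), line `registered`
(`Cruxes/UnitriangularCostShape/Lines/birth.lean`), stub `stub_productModel` (the Weyl-type product model of
`U(u_d)/I^(s+1)` over the truncated Casimir algebra, `b = k = ⌊d/2⌋`).  Helper vocabulary and lemmas, namespace
`…Theorems.UnitriangularCostShape.ProductModel`.

Generic definitions over a commutative ring `R` for the oscillator-tower (polynomial Kirillov) model of the
upper unitriangular group `U_d`: model variables `Var d` (positions `(i, j)`, `i < j`, `i + j + 1 ≥ d`; column `j`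
is the level, `(d-1-j, j)` its central variable), weights `wt (i, j) = j - i`, the substitution endomorphism
`sigma c` and the linear form `nvec c` of a coefficient matrix `c`, and the group law
`sigma c ∘ sigma c' = sigma (c c')`, `nvec (c c') = nvec c + sigma c (nvec c')` for upper unitriangular `c, c'`.
-/

set_option linter.dupNamespace false

noncomputable section

namespace Summit.MatrixMultiplication.MatrixMultiplication.Theorems.UnitriangularCostShape.ProductModel

open MvPolynomial
open scoped BigOperators

/-- Model variables of the oscillator tower of `U_d`: positions `(i, j)`, `i < j`, `i + j + 1 ≥ d`. -/
abbrev Var (d : ℕ) : Type := {p : Fin d × Fin d // p.1 < p.2 ∧ d ≤ (p.1 : ℕ) + p.2 + 1}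

namespace Var

variable {d : ℕ}

/-- Row index of a model variable. -/
abbrev row (u : Var d) : Fin d := u.1.1

/-- Column index (= level) of a model variable. -/
abbrev col (u : Var d) : Fin d := u.1.2

/-- Weight of a model variable: `j - i`. -/
def wt (u : Var d) : ℕ := (u.col : ℕ) - u.row

/-- A model variable lies strictly above the diagonal. -/
theorem row_lt_col (u : Var d) : u.row < u.col := u.2.1

/-- A model variable lies on or above the anti-diagonal: `i + j + 1 ≥ d`. -/
theorem le_row_add_col (u : Var d) : d ≤ (u.row : ℕ) + u.col + 1 := u.2.2

/-- Weights of model variables are positive. -/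
theorem one_le_wt (u : Var d) : 1 ≤ u.wt := by
  have h : (u.row : ℕ) < u.col := u.row_lt_col
  unfold wt
  omega

end Var

variable {d : ℕ} {R : Type*} [CommRing R]

/-- Image of the variable `u = (k, j)` under the substitution attached to `c`:
`X (k, j) + Σ_{i < k, (i, j) ∈ Var} c i k • X (i, j)` (diagonal forced to `1`, lower part ignored). -/
def sigmaX (c : Matrix (Fin d) (Fin d) R) (u : Var d) : MvPolynomial (Var d) R :=
  X u + ∑ u' : Var d, if u'.col = u.col ∧ u'.row < u.row then C (c u'.row u.row) * X u' else 0

/-- The substitution endomorphism `σ_c` of `R[Var d]`. -/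
def sigma (c : Matrix (Fin d) (Fin d) R) : MvPolynomial (Var d) R →ₐ[R] MvPolynomial (Var d) R :=
  aeval (sigmaX c)

/-- `σ_c` on a variable. -/
@[simp] theorem sigma_X (c : Matrix (Fin d) (Fin d) R) (u : Var d) : sigma c (X u) = sigmaX c u := by
  simp [sigma]

/-- `σ_c` fixes constants. -/
@[simp] theorem sigma_C (c : Matrix (Fin d) (Fin d) R) (r : R) : sigma c (C r) = C r := by
  simp [sigma]

/-- The linear form `n_c = Σ_u c_u • X u` (entry of `c` at the position of the variable). -/
def nvec (c : Matrix (Fin d) (Fin d) R) : MvPolynomial (Var d) R :=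
  ∑ u : Var d, C (c u.row u.col) * X u

/-- For unitriangular `c`, `σ_c (X (k, j)) = Σ_{(i, j) ∈ Var} c i k • X (i, j)` (full column sum). -/
theorem sigmaX_eq_of_isUT {c : Matrix (Fin d) (Fin d) R}
    (hc : ∀ i j : Fin d, j ≤ i → c i j = if i = j then 1 else 0) (u : Var d) :
    sigmaX c u = ∑ u' : Var d, if u'.col = u.col then C (c u'.row u.row) * X u' else 0 := by
  classical
  unfold sigmaX
  have key : ∀ u' : Var d, (if u'.col = u.col then C (c u'.row u.row) * X u' else 0) =
      (if u' = u then X u else 0) +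
      (if u'.col = u.col ∧ u'.row < u.row then C (c u'.row u.row) * X u' else 0) := by
    intro u'
    by_cases h1 : u'.col = u.col
    · by_cases h2 : u'.row < u.row
      · have hne : u' ≠ u := by
          intro h; subst h; exact lt_irrefl _ h2
        simp [h1, h2, hne]
      · by_cases h3 : u' = u
        · subst h3
          have : c u'.row u'.row = 1 := by
            have := hc u'.row u'.row le_rfl
            simpa using this
          simp [this]
        · have hlt : u.row < u'.row := by
            rcases lt_trichotomy u'.row u.row with h | h | h
            · exact absurd h h2
            · exfalso; apply h3
              apply Subtype.ext
              exact Prod.ext h h1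
            · exact h
          have : c u'.row u.row = 0 := by
            have := hc u'.row u.row hlt.le
            simpa [ne_of_gt hlt] using this
          simp [h1, h2, h3, this]
    · have hne : u' ≠ u := by intro h; subst h; exact h1 rfl
      simp [h1, hne]
  simp_rw [key, Finset.sum_add_distrib, Finset.sum_ite_eq' Finset.univ u, Finset.mem_univ, if_true]

/-- Reindexing a column sum over `Var d` as a sum over `Fin d`. -/
theorem sum_var_col {M : Type*} [AddCommMonoid M] (j : Fin d) (F : Fin d → M) :
    ∑ u : Var d, (if u.col = j then F u.row else 0) =
      ∑ i : Fin d, if (i < j ∧ d ≤ (i : ℕ) + j + 1) then F i else 0 := by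
  classical
  have h1 : ∑ u : Var d, (if u.col = j then F u.row else 0) =
      ∑ p ∈ (Finset.univ : Finset (Fin d × Fin d)).filter
        (fun p => p.1 < p.2 ∧ d ≤ (p.1 : ℕ) + p.2 + 1), (if p.2 = j then F p.1 else 0) := by
    rw [Finset.sum_subtype (p := fun p : Fin d × Fin d => p.1 < p.2 ∧ d ≤ (p.1 : ℕ) + p.2 + 1)]
    intro x; simp
  rw [h1, Finset.sum_filter, Fintype.sum_prod_type]
  refine Finset.sum_congr rfl fun i _ => ?_
  rw [Finset.sum_eq_single j]
  · by_cases h : i < j ∧ d ≤ (i : ℕ) + j + 1 <;> simp [h]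
  · intro b _ hb; simp [hb]
  · intro h; exact absurd (Finset.mem_univ j) h

/-- Group law for the substitution: `σ_c (σ_{c'} f) = σ_{c c'} f` for upper unitriangular `c, c'`. -/
theorem sigma_sigma {c c' : Matrix (Fin d) (Fin d) R}
    (hc : ∀ i j : Fin d, j ≤ i → c i j = if i = j then 1 else 0)
    (hc' : ∀ i j : Fin d, j ≤ i → c' i j = if i = j then 1 else 0)
    (f : MvPolynomial (Var d) R) : sigma c (sigma c' f) = sigma (c * c') f := by
  classical
  have hcc' : ∀ i j : Fin d, j ≤ i → (c * c') i j = if i = j then 1 else 0 := by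
    intro i j hji
    rw [Matrix.mul_apply]
    by_cases hij : i = j
    · subst hij
      rw [Finset.sum_eq_single i]
      · simp [hc i i le_rfl, hc' i i le_rfl]
      · intro k _ hk
        rcases lt_or_gt_of_ne hk with h | h
        · rw [hc i k h.le]; simp [ne_of_gt h]
        · rw [hc' k i h.le]; simp [ne_of_gt h]
      · intro h; exact absurd (Finset.mem_univ i) h
    · rw [if_neg hij]
      refine Finset.sum_eq_zero fun k _ => ?_
      have hji' : j < i := lt_of_le_of_ne hji (Ne.symm hij)
      by_cases hk : k < i
      · rw [hc i k hk.le]; simp [ne_of_gt hk]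
      · push Not at hk
        have : j < k := lt_of_lt_of_le hji' hk
        rw [hc' k j this.le]; simp [ne_of_gt this]
  suffices h : (sigma c).comp (sigma c') = sigma (c * c') by
    have := congrArg (fun φ => φ f) h
    simpa using this
  refine MvPolynomial.algHom_ext fun u => ?_
  rw [AlgHom.comp_apply, sigma_X, sigma_X, sigmaX_eq_of_isUT hc', sigmaX_eq_of_isUT hcc', map_sum]
  have step : ∀ u' : Var d, sigma c (if u'.col = u.col then C (c' u'.row u.row) * X u' else 0) =
      ∑ u'' : Var d, if u''.col = u.col then
        (if u'.col = u.col then C (c u''.row u'.row * c' u'.row u.row) * X u'' else 0) else 0 := by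
    intro u'
    by_cases h : u'.col = u.col
    · rw [if_pos h, map_mul, sigma_C, sigma_X, sigmaX_eq_of_isUT hc, Finset.mul_sum]
      simp only [h, if_true]
      refine Finset.sum_congr rfl fun u'' _ => ?_
      by_cases h'' : u''.col = u.col
      · simp only [h'', if_true, map_mul]; ring
      · simp [h'']
    · simp [h]
  simp_rw [step]
  rw [Finset.sum_comm]
  refine Finset.sum_congr rfl fun u'' _ => ?_
  by_cases h'' : u''.col = u.col
  · simp only [h'', if_true]
    have := sum_var_col (M := MvPolynomial (Var d) R) u.col
      (fun i => C (c u''.row i * c' i u.row) * X u'')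
    rw [this, Matrix.mul_apply, map_sum, Finset.sum_mul]
    refine Finset.sum_congr rfl fun i _ => ?_
    by_cases hi : i < u.col ∧ d ≤ (i : ℕ) + u.col + 1
    · rw [if_pos hi]
    · rw [if_neg hi]
      -- the omitted terms vanish
      rcases not_and_or.mp hi with h1 | h1
      · push Not at h1
        have hlt : u.row < i := lt_of_lt_of_le u.2.1 h1
        rw [hc' i u.row hlt.le, if_neg (ne_of_gt hlt)]; simp
      · push Not at h1
        have hlt : i < u''.row := by
          have := u''.le_row_add_col; rw [h''] at this
          exact Fin.lt_def.mpr (by omega)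
        rw [hc u''.row i hlt.le, if_neg (ne_of_gt hlt)]; simp
  · simp [h'']

/-- Group law for the linear form: `n_{c c'} = n_c + σ_c (n_{c'})` for upper unitriangular `c, c'`. -/
theorem nvec_mul {c c' : Matrix (Fin d) (Fin d) R}
    (hc : ∀ i j : Fin d, j ≤ i → c i j = if i = j then 1 else 0)
    (hc' : ∀ i j : Fin d, j ≤ i → c' i j = if i = j then 1 else 0) :
    nvec (c * c') = nvec c + sigma c (nvec c') := by
  classical
  unfold nvec
  rw [map_sum]
  have step : ∀ u : Var d, sigma c (C (c' u.row u.col) * X u) =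
      ∑ u'' : Var d, if u''.col = u.col then C (c u''.row u.row * c' u.row u.col) * X u'' else 0 := by
    intro u
    rw [map_mul, sigma_C, sigma_X, sigmaX_eq_of_isUT hc, Finset.mul_sum]
    refine Finset.sum_congr rfl fun u'' _ => ?_
    by_cases h'' : u''.col = u.col
    · simp only [h'', if_true, map_mul]; ring
    · simp [h'']
  simp_rw [step]
  rw [Finset.sum_comm, ← Finset.sum_add_distrib]
  refine Finset.sum_congr rfl fun u'' _ => ?_
  have := sum_var_col (M := MvPolynomial (Var d) R) u''.col
    (fun i => C (c u''.row i * c' i u''.col) * X u'')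
  have e : (∑ u : Var d, if u''.col = u.col then C (c u''.row u.row * c' u.row u.col) * X u'' else 0) =
      ∑ u : Var d, if u.col = u''.col then C (c u''.row u.row * c' u.row u''.col) * X u'' else 0 := by
    refine Finset.sum_congr rfl fun u _ => ?_
    by_cases h : u.col = u''.col
    · simp [h]
    · simp [h, Ne.symm h]
  rw [e, this, Matrix.mul_apply, map_sum, Finset.sum_mul]
  -- split off the diagonal term `i = u''.col`
  rw [← Finset.add_sum_erase Finset.univ _ (Finset.mem_univ u''.col)]
  congr 1
  · rw [hc' u''.col u''.col le_rfl, if_pos rfl, mul_one]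
  · rw [← Finset.sum_erase (f := fun i => if i < u''.col ∧ d ≤ (i : ℕ) + u''.col + 1 then
        C (c u''.row i * c' i u''.col) * X u'' else 0) Finset.univ (a := u''.col) (by simp)]
    refine Finset.sum_congr rfl fun i hi => ?_
    rw [Finset.mem_erase] at hi
    by_cases h : i < u''.col ∧ d ≤ (i : ℕ) + u''.col + 1
    · rw [if_pos h]
    · rw [if_neg h]
      rcases not_and_or.mp h with h1 | h1
      · push Not at h1
        have hlt : u''.col < i := lt_of_le_of_ne h1 (Ne.symm hi.1)
        rw [hc' i u''.col hlt.le, if_neg (ne_of_gt hlt)]; simp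
      · push Not at h1
        have hlt : i < u''.row := by
          have := u''.le_row_add_col
          exact Fin.lt_def.mpr (by omega)
        rw [hc u''.row i hlt.le, if_neg (ne_of_gt hlt)]; simp

/-- Landing hook of part 1: the group law of the substitution. -/
theorem stub_pm_groupLaw : ∀ (d : ℕ) (R : Type) [CommRing R] (c c' : Matrix (Fin d) (Fin d) R), (∀ i j : Fin d, j ≤ i → c i j = if i = j then 1 else 0) → (∀ i j : Fin d, j ≤ i → c' i j = if i = j then 1 else 0) → ∀ f : MvPolynomial (Var d) R, sigma c (sigma c' f) = sigma (c * c') f :=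
  fun _ _ _ _ _ hc hc' f => sigma_sigma hc hc' f

end Summit.MatrixMultiplication.MatrixMultiplication.Theorems.UnitriangularCostShape.ProductModel
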